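import Mathlib
import HarnessLib
import Summits.HubbardSuperconductivity.HubbardSuperconductivity.Theorems.KLProgrammeSWaveCascadeAllScales

/-!
# Route `KLProgramme` — row 0′ (child 1), CARRIER-GENERIC: the TOTAL VARIATION ACROSS SCALES of the ball amplitudes is `U`-CURRENCY
# (composed-map remainder propagation: each ladder step = the scalar Riccati decrement `u_{i+1} − u_i` on every entry + a remainder of scale sum `O(U) + O(A+R)`)

Cell gate-hubbard-kl, seat hubbard-kl-k3c1-p1 (g19; child-1 lineage; technique «composed-map remainder propagation»).  Sequel to `…SWaveCascadeAllScales` (p701157) and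
`…SWaveCascadeArrayAllScales` (p701450) under pen g25 (R372)(B) «CHILD1-ALLSCALES-EXPORT»; bears on (R366)(q-α2)/(R367) («the L¹ accumulation AT THE PINNED TRANSFER»):
there the registrant found that the engine's value-INCREMENT slots sum to `(Klam U)²·n` at the pinned transfer (not `U`-currency), while child 1's envelope carries
no cross-scale link.  This file proves the cross-scale statement for the AMPLITUDES THEMSELVES, generically: under the hypotheses of `matrixLadder_envelope_edge`
(`…SWaveCascadeMatrixEdge`) VERBATIM, on the ball `B × B`,
`Σ_{i<n} ‖C (i+1) k k' − C i k k'‖ ≤ (11/9)·U + (3/2)·((ι₀ + Στ + Xtot) + (Στ + Xsup))` — `U`-currency uniformly in the number of in-class scales `n`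
(**`matrixLadder_variation_edge`**, which also re-exports everything `matrixLadder_envelope_edge_allScales`
exports plus the per-step INCREMENT LAW `‖C (i+1) k k' − C i k k' − (Us (i+1) − Us i)‖ ≤ m_i·((2Ū + d + R)·d + R·Ū) + τ_i + X_{i+1} k k'`, `Ū = 16U/15`, `d = 12(A+R)`:
every entry moves by the SAME scalar Riccati decrement up to a remainder carrying the ℓ¹ mass `m_i`).  Mechanism (proof = the body of `matrixLadder_envelope_edge` — adapted
from that file — followed by the remainder propagation): with `𝒞_i = Us i·J + D_i`, `esup D_i ≤ d` (the all-scales cascade envelope), the restricted step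
`𝒞_{i+1} = 𝒞_i − 𝒞_{i+1} ∗_{w_i} 𝒞_i + Δ_i + Δ_i ∗_{w_i} 𝒞_i` and the exact scalar law `Us (i+1) − Us i = −W_i·Us i·Us (i+1)` (`sWaveFloor_succ_sub`) give
an entrywise remainder `≤ m_i(2Ū d + d² + R(Ū + d)) + e_i`; summing, `Σ_i |Us(i+1) − Us i| ≤ (257/225)·U` (`sWaveFloor_totalVariation_le'`), `Σ_i e_i ≤ A`, and the
no-onset smallness `336·(A+R)·Σ_i m_i ≤ 1` absorbs the mass-weighted remainders into `(5/63)·U + (13/28)·(A+R)`.  **`amplitudeLadder_variation_edge`**: the same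
through the ball-truncated array.  Everything is proved; no definitions; nothing about the model is asserted; nothing asserts superconductivity.
-/

noncomputable section

namespace Summit.HubbardSuperconductivity.HubbardSuperconductivity.Theorems.SWaveCascade

set_option linter.dupNamespace false -- summit = problem name (single-conjunct summit), D-0017

open Finset

variable {S : Type*} [Fintype S] [DecidableEq S]

omit [DecidableEq S] in
/-- `esup J ≤ 1`-type entry bound: every entry of `u • J + D` has norm `≤ |u| + esup D`. -/
theorem norm_smul_onesArr_add_le (u : ℝ) (D : S → S → ℂ) (s t : S) :
    ‖(((u : ℝ) : ℂ) • (onesArr : S → S → ℂ) + D) s t‖ ≤ |u| + esup D := by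
  simp only [Pi.add_apply, Pi.smul_apply, smul_eq_mul, onesArr, mul_one]
  exact (norm_add_le _ _).trans (by rw [Complex.norm_real, Real.norm_eq_abs]; exact add_le_add le_rfl (le_esup D s t))

/-- **Row 0′ at matrix level, carrier-generic: ALL-SCALES EXPORT + INCREMENT LAW + `U`-CURRENCY TOTAL VARIATION.**  Hypotheses = those of
`matrixLadder_envelope_edge` verbatim.  Conclusion: the export of `matrixLadder_envelope_edge_allScales` (comparison sequence `Us`, exact law, signed masses `W`, ℓ¹ masses
`m`, negative-mass line, envelope at every scale), AND for every `i < n` on `B × B` the increment law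
`‖C (i+1) k k' − C i k k' − (Us (i+1) − Us i)‖ ≤ m i·((2·(16U/15) + 12(A+R) + R)·(12(A+R)) + R·(16U/15)) + τ i + X (i+1) k k'`, AND the total variation
`Σ_{i<n} ‖C (i+1) k k' − C i k k'‖ ≤ (11/9)·U + (3/2)·(A+R)`, where `A = ι₀ + Στ + Xtot`, `R = Στ + Xsup`. -/
theorem matrixLadder_variation_edge (B : Finset S) (C : ℕ → Matrix S S ℂ) (hCsupp : ∀ i u, u ∉ B → ∀ t, C i u t = 0)
    {U b ι₀ : ℝ} (hU : 0 ≤ U) (hι₀ : 0 ≤ ι₀) (τ : ℕ → ℝ) (hτ0 : ∀ j, 0 ≤ τ j) {n : ℕ}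
    (X : ℕ → S → S → ℝ) {Xtot Xsup : ℝ} (hX0 : ∀ j k k', 0 ≤ X j k k')
    (hXsup : ∀ i < n, ∀ k k', X (i + 1) k k' ≤ Xsup) (hXtot : ∀ k k', X 0 k k' + ∑ i ∈ range n, X (i + 1) k k' ≤ Xtot)
    (hXtot0 : 0 ≤ Xtot) (hXsup0 : 0 ≤ Xsup) (δ : ℕ → ℝ) (hneg : 16 * U * ∑ i ∈ range n, δ i ≤ 1)
    (h0 : ∀ k ∈ B, ∀ k' ∈ B, ‖C 0 k k' - (U : ℂ)‖ ≤ ι₀ + X 0 k k')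
    (hsteps : ∀ i < n, ∃ w : S → ℝ, (∑ p, |w p| ≤ b) ∧ (∑ p, (|w p| - w p) ≤ δ i) ∧
      ∃ N : Matrix S S ℂ, (1 + Matrix.diagonal (fun p => (w p : ℂ)) * C i) * N = 1 ∧
        ∀ k ∈ B, ∀ k' ∈ B, ‖C (i + 1) k k' - (C i * N) k k'‖ ≤ τ i + X (i + 1) k k')
    (hsmall : 8 * 42 * ((ι₀ + ∑ j ∈ range n, τ j + Xtot) + (∑ j ∈ range n, τ j + Xsup)) * (b * n) ≤ 1) :
    ∃ Us W m : ℕ → ℝ, Us 0 = U ∧ (∀ i, Us (i + 1) = Us i / (1 + W i * Us i)) ∧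
      (∀ i, |W i| ≤ m i) ∧ (∀ i < n, m i ≤ b ∧ m i - W i ≤ δ i) ∧ (∀ i, n ≤ i → W i = 0 ∧ m i = 0) ∧
      16 * U * ∑ i ∈ range n, (m i - W i) ≤ 1 ∧
      (∀ i ≤ n, 0 ≤ Us i ∧ Us i ≤ 16 / 15 * U ∧ ∀ k ∈ B, ∀ k' ∈ B,
        ‖C i k k' - (Us i : ℂ)‖ ≤ 12 * ((ι₀ + ∑ j ∈ range n, τ j + Xtot) + (∑ j ∈ range n, τ j + Xsup))) ∧
      (∀ i < n, ∀ k ∈ B, ∀ k' ∈ B,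
        ‖C (i + 1) k k' - C i k k' - ((Us (i + 1) - Us i : ℝ) : ℂ)‖ ≤
          m i * ((2 * (16 / 15 * U) + 12 * ((ι₀ + ∑ j ∈ range n, τ j + Xtot) + (∑ j ∈ range n, τ j + Xsup)) +
              (∑ j ∈ range n, τ j + Xsup)) * (12 * ((ι₀ + ∑ j ∈ range n, τ j + Xtot) + (∑ j ∈ range n, τ j + Xsup))) +
            (∑ j ∈ range n, τ j + Xsup) * (16 / 15 * U)) + τ i + X (i + 1) k k') ∧
      ∀ k ∈ B, ∀ k' ∈ B, ∑ i ∈ range n, ‖C (i + 1) k k' - C i k k'‖ ≤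
        11 / 9 * U + 3 / 2 * ((ι₀ + ∑ j ∈ range n, τ j + Xtot) + (∑ j ∈ range n, τ j + Xsup)) := by
  classical
  -- notation
  set Sτ : ℝ := ∑ j ∈ range n, τ j with hSτ
  have hSτ0 : 0 ≤ Sτ := sum_nonneg fun j _ => hτ0 j
  have hτle : ∀ i < n, τ i ≤ Sτ := fun i hi =>
    single_le_sum (f := τ) (fun j _ => hτ0 j) (mem_range.2 hi)
  set A : ℝ := ι₀ + Sτ + Xtot with hA
  set R : ℝ := Sτ + Xsup with hR
  have hA0 : 0 ≤ A := by positivity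
  -- the step data
  choose! wt hwtabs hwtneg Nm hNm happ using hsteps
  -- the matrices Δ, T and the full-carrier implicit step
  set Δ : ℕ → Matrix S S ℂ := fun i => C (i + 1) - C i * Nm i with hΔ
  set T : ℕ → Matrix S S ℂ :=
    fun i => Δ i + Δ i * Matrix.diagonal (fun p => (wt i p : ℂ)) * C i with hT
  have hfull : ∀ i < n, C (i + 1) = C i - C (i + 1) * Matrix.diagonal (fun p => (wt i p : ℂ)) * C i + T i :=
    fun i hi => implicit_step_of_rightInverse (wt i) (hNm i hi) (by simp only [hΔ]; abel)
  -- restriction to the ball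
  set 𝒞r : ℕ → ↥B → ↥B → ℂ := fun i => resArr B (C i) with h𝒞r
  set wr : ℕ → ↥B → ℝ := fun i u => if i < n then wt i u.1 else 0 with hwr
  set Δr : ℕ → ↥B → ↥B → ℂ := fun i => resArr B (Δ i) with hΔr
  have hwr_eq : ∀ i < n, wr i = fun u : ↥B => wt i u.1 := fun i hi => funext fun u => if_pos hi
  have hwr_zero : ∀ i, n ≤ i → wr i = fun _ : ↥B => 0 := fun i hi => funext fun u => if_neg (not_lt.2 hi)
  -- the masses on the ball: ℓ¹ `≤ b`, sign defect `≤ δ`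
  have hmr : ∀ i < n, ∑ u, |wr i u| ≤ b := fun i hi => by
    rw [hwr_eq i hi]
    calc ∑ u : ↥B, |wt i u.1| = ∑ u ∈ B, |wt i u| := Finset.sum_coe_sort B (fun u => |wt i u|)
      _ ≤ ∑ u, |wt i u| := sum_le_sum_of_subset_of_nonneg (subset_univ B) fun u _ _ => abs_nonneg _
      _ ≤ b := hwtabs i hi
  have hmr0 : ∀ i, 0 ≤ ∑ u, |wr i u| := fun i => sum_nonneg fun u _ => abs_nonneg _
  have hνr : ∀ i < n, (∑ u, |wr i u|) - ∑ u, wr i u ≤ δ i := fun i hi => by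
    rw [hwr_eq i hi, Finset.sum_coe_sort B (fun u => |wt i u|), Finset.sum_coe_sort B (wt i), ← sum_sub_distrib]
    calc ∑ u ∈ B, (|wt i u| - wt i u) ≤ ∑ u, (|wt i u| - wt i u) :=
          sum_le_sum_of_subset_of_nonneg (subset_univ B) fun u _ _ => sub_nonneg.2 (le_abs_self _)
      _ ≤ δ i := hwtneg i hi
  have hTr_eq : ∀ i < n, resArr B (T i) = Δr i + wmul (wr i) (Δr i) (𝒞r i) := by
    intro i hi
    funext k k'
    have hw := congrFun (congrFun (resArr_wmul B (wt i) (Δ i) (C i) (hCsupp i)) k) k'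
    rw [← hwr_eq i hi] at hw
    simp only [resArr] at hw
    simp only [hT, h𝒞r, hΔr, Pi.add_apply, resArr, Matrix.add_apply, mul_diagonal_mul_apply_eq_wmul, hw]
  have hstepr : ∀ i < n, 𝒞r (i + 1) = 𝒞r i - wmul (wr i) (𝒞r (i + 1)) (𝒞r i) + resArr B (T i) := by
    intro i hi
    funext k k'
    have h := congrFun (congrFun (hfull i hi) k.1) k'.1
    have hw := congrFun (congrFun (resArr_wmul B (wt i) (C (i + 1)) (C i) (hCsupp i)) k) k'
    rw [← hwr_eq i hi] at hw
    simp only [resArr] at hw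
    rw [Matrix.add_apply, Matrix.sub_apply, mul_diagonal_mul_apply_eq_wmul, hw] at h
    simp only [h𝒞r, Pi.add_apply, Pi.sub_apply, resArr]
    exact h
  -- the repulsive scalar cascade on the ball
  obtain ⟨Us, hUs0, hUss⟩ : ∃ Us : ℕ → ℝ, Us 0 = U ∧ ∀ i, Us (i + 1) = Us i / (1 + (∑ u, wr i u) * Us i) :=
    ⟨fun i => Nat.rec U (fun i u => u / (1 + (∑ v, wr i v) * u)) i, rfl, fun i => rfl⟩
  have hUs0' : 0 ≤ Us 0 := by rw [hUs0]; exact hU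
  have hneg' : 16 * Us 0 * ∑ j ∈ range n, ((∑ u, |wr j u|) - ∑ u, wr j u) ≤ 1 := by
    rw [hUs0]
    refine le_trans ?_ hneg
    exact mul_le_mul_of_nonneg_left (sum_le_sum fun j hj => hνr j (mem_range.1 hj)) (by positivity)
  have hUs_nonneg : ∀ i ≤ n, 0 ≤ Us i := fun i hi =>
    (sWaveFloor_bounds (U := Us) (W := fun i => ∑ u, wr i u) (ν := fun i => (∑ u, |wr i u|) - ∑ u, wr i u) hUs0' hUss
      (fun i => show -((∑ u, |wr i u|) - ∑ u, wr i u) ≤ ∑ u, wr i u by linarith [hmr0 i])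
      (fun i => sub_nonneg.2 (sum_le_sum_abs (wr i))) hneg' i hi).1
  -- the split of the tail: core + column source
  set 𝒟r : ℕ → ↥B → ↥B → ℂ := fun i => 𝒞r i - ((Us i : ℝ) : ℂ) • onesArr with h𝒟r
  set Er : ℕ → ↥B → ↥B → ℂ := fun i => Δr i + wmul (wr i) (Δr i) (𝒟r i) with hEr
  set cr : ℕ → ↥B → ℂ := fun i s => ((Us i : ℝ) : ℂ) * ∑ u, Δr i s u * (wr i u : ℂ) with hcr
  have hsplit : ∀ i < n, resArr B (T i) = Er i + fun s _ => cr i s := by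
    intro i hi
    rw [hTr_eq i hi]
    have h𝒞 : 𝒞r i = ((Us i : ℝ) : ℂ) • onesArr + 𝒟r i := by simp only [h𝒟r]; abel
    funext s t
    simp only [hEr, hcr, Pi.add_apply]
    conv_lhs => rw [h𝒞]
    rw [wmul_add_right, wmul_smul_right]
    simp only [Pi.add_apply, Pi.smul_apply, smul_eq_mul, wmul_onesArr_right_eq]
    ring
  have hstep' : ∀ i < n, 𝒞r (i + 1) = 𝒞r i - wmul (wr i) (𝒞r (i + 1)) (𝒞r i) + (Er i + fun s _ => cr i s) := by
    intro i hi
    have h := hstepr i hi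
    rw [hsplit i hi] at h
    exact h
  -- the entrywise majorant of the remainder
  set e : ℕ → ↥B → ↥B → ℝ := fun i s t => τ i + X (i + 1) s.1 t.1 with he
  have he0 : ∀ i s t, 0 ≤ e i s t := fun i s t => add_nonneg (hτ0 i) (hX0 _ _ _)
  have hΔr_le : ∀ i < n, ∀ s t : ↥B, ‖Δr i s t‖ ≤ e i s t := by
    intro i hi s t
    have := happ i hi s.1 s.2 t.1 t.2
    simpa [hΔr, hΔ, resArr, Matrix.sub_apply, he] using this
  have he_le_R : ∀ i < n, ∀ s t : ↥B, e i s t ≤ R := by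
    intro i hi s t
    have h1 := hτle i hi
    have h2 := hXsup i hi s.1 t.1
    simp only [he, hR] at *
    linarith
  have hR0 : 0 ≤ R := by positivity
  have hΔr_sup : ∀ i < n, esup (Δr i) ≤ R := fun i hi =>
    esup_le (fun s t => (hΔr_le i hi s t).trans (he_le_R i hi s t)) hR0
  -- hypotheses of the cascade lemma
  have hE : ∀ i < n, ∀ s t, ‖Er i s t‖ ≤ e i s t + R * (∑ u, |wr i u|) * esup (𝒞r i - ((Us i : ℝ) : ℂ) • onesArr) := by
    intro i hi s t
    have h1 := hΔr_le i hi s t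
    have h2 : ‖wmul (wr i) (Δr i) (𝒟r i) s t‖ ≤ esup (Δr i) * (∑ u, |wr i u|) * esup (𝒟r i) :=
      (le_esup _ s t).trans (esup_wmul_le_abs (wr i) _ _)
    have h3 : esup (Δr i) * (∑ u, |wr i u|) * esup (𝒟r i) ≤ R * (∑ u, |wr i u|) * esup (𝒟r i) :=
      mul_le_mul_of_nonneg_right (mul_le_mul_of_nonneg_right (hΔr_sup i hi) (hmr0 i)) (esup_nonneg _)
    calc ‖Er i s t‖ = ‖Δr i s t + wmul (wr i) (Δr i) (𝒟r i) s t‖ := rfl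
      _ ≤ ‖Δr i s t‖ + ‖wmul (wr i) (Δr i) (𝒟r i) s t‖ := norm_add_le _ _
      _ ≤ e i s t + R * (∑ u, |wr i u|) * esup (𝒟r i) := by linarith
  have hc : ∀ i < n, ∀ s, ‖cr i s‖ ≤ Us i * (∑ u, |wr i u|) * R := by
    intro i hi s
    have h1 : ‖∑ u, Δr i s u * (wr i u : ℂ)‖ ≤ (∑ u, |wr i u|) * esup (Δr i) :=
      norm_sum_mul_le_abs fun u => le_esup (Δr i) s u
    calc ‖cr i s‖ = Us i * ‖∑ u, Δr i s u * (wr i u : ℂ)‖ := by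
          simp only [hcr, norm_mul, Complex.norm_real, Real.norm_eq_abs, abs_of_nonneg (hUs_nonneg i hi.le)]
      _ ≤ Us i * ((∑ u, |wr i u|) * R) :=
          mul_le_mul_of_nonneg_left (h1.trans (mul_le_mul_of_nonneg_left (hΔr_sup i hi) (hmr0 i))) (hUs_nonneg i hi.le)
      _ = Us i * (∑ u, |wr i u|) * R := by ring
  have ha : ∀ s t : ↥B, ‖𝒞r 0 s t - ((Us 0 : ℝ) : ℂ)‖ + ∑ j ∈ range n, e j s t ≤ A := by
    intro s t
    have h0' : ‖𝒞r 0 s t - ((Us 0 : ℝ) : ℂ)‖ ≤ ι₀ + X 0 s.1 t.1 := by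
      rw [hUs0]
      have := h0 s.1 s.2 t.1 t.2
      simpa [h𝒞r, resArr] using this
    have h1 : ∑ j ∈ range n, e j s t = Sτ + ∑ j ∈ range n, X (j + 1) s.1 t.1 := by
      simp only [he, hSτ, sum_add_distrib]
    have h2 := hXtot s.1 t.1
    rw [h1, hA]
    linarith
  have hsmall' : 8 * 42 * (A + R) * ∑ j ∈ range n, (∑ u, |wr j u|) ≤ 1 := by
    refine le_trans ?_ hsmall
    have hW : ∑ j ∈ range n, (∑ u, |wr j u|) ≤ b * n := by
      calc ∑ j ∈ range n, (∑ u, |wr j u|) ≤ ∑ j ∈ range n, b := sum_le_sum fun j hj => hmr j (mem_range.1 hj)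
        _ = b * n := by rw [sum_const, card_range, nsmul_eq_mul, mul_comm]
    have : 8 * 42 * (A + R) * ∑ j ∈ range n, (∑ u, |wr j u|) ≤ 8 * 42 * (A + R) * (b * n) :=
      mul_le_mul_of_nonneg_left hW (by positivity)
    refine this.trans (le_of_eq ?_)
    simp only [hA, hR, hSτ]
  -- the cascade lemma, at every scale
  have hmain := sWaveCascade_envelope_edge (w := wr) (𝒞 := 𝒞r) (E := Er) (c := cr) (e := e) (U := Us) (N := n)
    (a := A) (r := R) hUs0' hUss hstep' he0 hE hA0 ha hR0 hc hneg' hsmall'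
  -- the scalar cascade data in the shape of `…SWaveCascadeEdgeAlgebra` / `…SWaveCascadeAllScales` §1
  have hWν : ∀ i, -((∑ u, |wr i u|) - ∑ u, wr i u) ≤ ∑ u, wr i u := fun i => by linarith [hmr0 i]
  have hν0 : ∀ i, 0 ≤ (∑ u, |wr i u|) - ∑ u, wr i u := fun i => sub_nonneg.2 (sum_le_sum_abs (wr i))
  have hfs := sWaveFloor_step (U := Us) (W := fun i => ∑ u, wr i u) (ν := fun i => (∑ u, |wr i u|) - ∑ u, wr i u) hUs0' hUss hWν hν0 hneg'
  have htv := sWaveFloor_totalVariation_le' (U := Us) (W := fun i => ∑ u, wr i u) (ν := fun i => (∑ u, |wr i u|) - ∑ u, wr i u)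
    hUs0' hUss hWν hν0 hneg'
  rw [hUs0] at htv
  -- abbreviations for the envelope radius `d = 12 (A + R)` and the value ceiling `Ū = (16/15) U`
  obtain ⟨d, hd⟩ : ∃ d : ℝ, d = 12 * (A + R) := ⟨_, rfl⟩
  obtain ⟨Ub, hUb⟩ : ∃ Ub : ℝ, Ub = 16 / 15 * U := ⟨_, rfl⟩
  have hd0 : 0 ≤ d := by rw [hd]; positivity
  have hUb0 : 0 ≤ Ub := by rw [hUb]; positivity
  have hUsb : ∀ i ≤ n, 0 ≤ Us i ∧ Us i ≤ Ub := fun i hi => by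
    have h := (hmain i hi).1; rw [hUs0, ← hUb] at h; exact h
  have hDle : ∀ i ≤ n, esup (𝒟r i) ≤ d := fun i hi => by rw [hd]; exact (hmain i hi).2
  have h𝒞entry : ∀ i ≤ n, ∀ v t : ↥B, ‖𝒞r i v t‖ ≤ Ub + d := by
    intro i hi v t
    have h𝒞 : 𝒞r i = ((Us i : ℝ) : ℂ) • onesArr + 𝒟r i := by simp only [h𝒟r]; abel
    rw [h𝒞]
    refine (norm_smul_onesArr_add_le (Us i) (𝒟r i) v t).trans ?_
    rw [abs_of_nonneg (hUsb i hi).1]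
    exact add_le_add (hUsb i hi).2 (hDle i hi)
  have h𝒞sup : ∀ i ≤ n, esup (𝒞r i) ≤ Ub + d := fun i hi => esup_le (h𝒞entry i hi) (by positivity)
  have h𝒟entry : ∀ i v t, 𝒟r i v t = 𝒞r i v t - ((Us i : ℝ) : ℂ) := fun i v t => by
    simp only [h𝒟r, Pi.sub_apply, Pi.smul_apply, smul_eq_mul, onesArr, mul_one]
  -- THE INCREMENT LAW on the ball
  have hincr : ∀ i < n, ∀ s t : ↥B,
      ‖𝒞r (i + 1) s t - 𝒞r i s t - ((Us (i + 1) - Us i : ℝ) : ℂ)‖ ≤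
        (∑ u, |wr i u|) * ((2 * Ub + d + R) * d + R * Ub) + e i s t := by
    intro i hi s t
    have hi1 : i + 1 ≤ n := Nat.succ_le_of_lt hi
    -- the step on the ball and the exact scalar law
    have hst := congrFun (congrFun (hstepr i hi) s) t
    rw [hTr_eq i hi] at hst
    simp only [Pi.add_apply, Pi.sub_apply] at hst
    have hsc : Us (i + 1) - Us i = -((∑ u, wr i u) * Us i * Us (i + 1)) := sWaveFloor_succ_sub hUss (hfs i hi).1
    -- the decomposition of the dressed product around `Us (i+1) · W · Us i`
    have hdec : wmul (wr i) (𝒞r (i + 1)) (𝒞r i) s t =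
        ((Us (i + 1) * (∑ u, wr i u) * Us i : ℝ) : ℂ) +
          (((Us (i + 1) : ℝ) : ℂ) * ∑ v, (wr i v : ℂ) * 𝒟r i v t + (∑ v, 𝒟r (i + 1) s v * (wr i v : ℂ)) * ((Us i : ℝ) : ℂ) +
            wmul (wr i) (𝒟r (i + 1)) (𝒟r i) s t) := by
      have e1 : ((Us (i + 1) * (∑ u, wr i u) * Us i : ℝ) : ℂ) = ∑ v, ((Us (i + 1) : ℝ) : ℂ) * (wr i v : ℂ) * ((Us i : ℝ) : ℂ) := by
        push_cast; rw [Finset.mul_sum, Finset.sum_mul]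
      rw [e1, Finset.mul_sum, Finset.sum_mul]
      simp only [wmul, ← Finset.sum_add_distrib]
      exact Finset.sum_congr rfl fun v _ => by rw [h𝒟entry i v t, h𝒟entry (i + 1) s v]; ring
    -- the three dressed remainders
    have hm0 := hmr0 i
    have hP1 : ‖((Us (i + 1) : ℝ) : ℂ) * ∑ v, (wr i v : ℂ) * 𝒟r i v t‖ ≤ Ub * ((∑ u, |wr i u|) * d) := by
      rw [norm_mul, Complex.norm_real, Real.norm_eq_abs, abs_of_nonneg (hUsb (i + 1) hi1).1]
      exact mul_le_mul (hUsb (i + 1) hi1).2 (norm_sum_mul_le_abs' fun v => (le_esup _ v t).trans (hDle i hi.le))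
        (norm_nonneg _) hUb0
    have hP2 : ‖(∑ v, 𝒟r (i + 1) s v * (wr i v : ℂ)) * ((Us i : ℝ) : ℂ)‖ ≤ ((∑ u, |wr i u|) * d) * Ub := by
      rw [norm_mul, Complex.norm_real, Real.norm_eq_abs, abs_of_nonneg (hUsb i hi.le).1]
      exact mul_le_mul (norm_sum_mul_le_abs fun v => (le_esup _ s v).trans (hDle (i + 1) hi1)) (hUsb i hi.le).2
        (hUsb i hi.le).1 (mul_nonneg hm0 hd0)
    have hP3 : ‖wmul (wr i) (𝒟r (i + 1)) (𝒟r i) s t‖ ≤ d * (∑ u, |wr i u|) * d :=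
      (le_esup _ s t).trans ((esup_wmul_le_abs (wr i) _ _).trans
        (mul_le_mul (mul_le_mul_of_nonneg_right (hDle (i + 1) hi1) hm0) (hDle i hi.le) (esup_nonneg _)
          (mul_nonneg hd0 hm0)))
    -- the two tail pieces
    have hT1 : ‖Δr i s t‖ ≤ e i s t := hΔr_le i hi s t
    have hT2 : ‖wmul (wr i) (Δr i) (𝒞r i) s t‖ ≤ R * (∑ u, |wr i u|) * (Ub + d) :=
      (le_esup _ s t).trans ((esup_wmul_le_abs (wr i) _ _).trans
        (mul_le_mul (mul_le_mul_of_nonneg_right (hΔr_sup i hi) hm0) (h𝒞sup i hi.le) (esup_nonneg _)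
          (mul_nonneg hR0 hm0)))
    -- assemble
    have hexpr : 𝒞r (i + 1) s t - 𝒞r i s t - ((Us (i + 1) - Us i : ℝ) : ℂ) =
        -(((Us (i + 1) : ℝ) : ℂ) * ∑ v, (wr i v : ℂ) * 𝒟r i v t + (∑ v, 𝒟r (i + 1) s v * (wr i v : ℂ)) * ((Us i : ℝ) : ℂ) +
            wmul (wr i) (𝒟r (i + 1)) (𝒟r i) s t) + Δr i s t + wmul (wr i) (Δr i) (𝒞r i) s t := by
      rw [hsc, hst, hdec]; push_cast; ring
    have hP : ‖-(((Us (i + 1) : ℝ) : ℂ) * ∑ v, (wr i v : ℂ) * 𝒟r i v t + (∑ v, 𝒟r (i + 1) s v * (wr i v : ℂ)) * ((Us i : ℝ) : ℂ) +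
        wmul (wr i) (𝒟r (i + 1)) (𝒟r i) s t)‖ ≤ Ub * ((∑ u, |wr i u|) * d) + ((∑ u, |wr i u|) * d) * Ub + d * (∑ u, |wr i u|) * d := by
      rw [norm_neg]
      exact (norm_add₃_le).trans (add_le_add (add_le_add hP1 hP2) hP3)
    have htarget : (∑ u, |wr i u|) * ((2 * Ub + d + R) * d + R * Ub) + e i s t =
        (Ub * ((∑ u, |wr i u|) * d) + ((∑ u, |wr i u|) * d) * Ub + d * (∑ u, |wr i u|) * d) + e i s t +
          R * (∑ u, |wr i u|) * (Ub + d) := by ring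
    rw [hexpr, htarget]
    exact (norm_add₃_le).trans (add_le_add (add_le_add hP hT1) hT2)
  -- summing the increment law: the no-onset smallness absorbs the mass-weighted remainders
  have hmass : 8 * 42 * (A + R) * ∑ j ∈ range n, (∑ u, |wr j u|) ≤ 1 := hsmall'
  set Ms : ℝ := ∑ j ∈ range n, (∑ u, |wr j u|) with hMs
  have hMs0 : 0 ≤ Ms := sum_nonneg fun j _ => hmr0 j
  have hMsd : Ms * d ≤ 1 / 28 := by rw [hd]; nlinarith [hmass]
  have hMsR : Ms * R ≤ 1 / 336 := by
    have hRle : R ≤ A + R := le_add_of_nonneg_left hA0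
    nlinarith [hmass, mul_le_mul_of_nonneg_left hRle hMs0]
  have habs : Ms * ((2 * Ub + d + R) * d + R * Ub) ≤ (2 * Ub + d + R) * (1 / 28) + Ub * (1 / 336) := by
    have h1 : Ms * ((2 * Ub + d + R) * d + R * Ub) = (2 * Ub + d + R) * (Ms * d) + Ub * (Ms * R) := by ring
    rw [h1]
    exact add_le_add (mul_le_mul_of_nonneg_left hMsd (by positivity)) (mul_le_mul_of_nonneg_left hMsR hUb0)
  have hTV : ∀ s t : ↥B, ∑ i ∈ range n, ‖𝒞r (i + 1) s t - 𝒞r i s t‖ ≤ 11 / 9 * U + 3 / 2 * (A + R) := by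
    intro s t
    have hterm : ∀ i ∈ range n, ‖𝒞r (i + 1) s t - 𝒞r i s t‖ ≤
        |Us (i + 1) - Us i| + ((∑ u, |wr i u|) * ((2 * Ub + d + R) * d + R * Ub) + e i s t) := by
      intro i hi
      have hi' := mem_range.1 hi
      have h := hincr i hi' s t
      have htri : ‖𝒞r (i + 1) s t - 𝒞r i s t‖ ≤ ‖((Us (i + 1) - Us i : ℝ) : ℂ)‖ +
          ‖𝒞r (i + 1) s t - 𝒞r i s t - ((Us (i + 1) - Us i : ℝ) : ℂ)‖ := by
        have h := norm_add_le (((Us (i + 1) - Us i : ℝ)) : ℂ) (𝒞r (i + 1) s t - 𝒞r i s t - ((Us (i + 1) - Us i : ℝ) : ℂ))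
        rwa [add_sub_cancel] at h
      rw [Complex.norm_real, Real.norm_eq_abs] at htri
      linarith
    have hsumE : ∑ i ∈ range n, e i s t ≤ A := by
      have h1 : ∑ j ∈ range n, e j s t = Sτ + ∑ j ∈ range n, X (j + 1) s.1 t.1 := by
        simp only [he, hSτ, sum_add_distrib]
      have h2 := hXtot s.1 t.1
      have h3 := hX0 0 s.1 t.1
      rw [h1, hA]
      linarith
    calc ∑ i ∈ range n, ‖𝒞r (i + 1) s t - 𝒞r i s t‖
        ≤ ∑ i ∈ range n, (|Us (i + 1) - Us i| + ((∑ u, |wr i u|) * ((2 * Ub + d + R) * d + R * Ub) + e i s t)) :=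
          sum_le_sum hterm
      _ = ∑ i ∈ range n, |Us (i + 1) - Us i| + (Ms * ((2 * Ub + d + R) * d + R * Ub) + ∑ i ∈ range n, e i s t) := by
          rw [sum_add_distrib, sum_add_distrib, hMs, sum_mul]
      _ ≤ 257 / 225 * U + ((2 * Ub + d + R) * (1 / 28) + Ub * (1 / 336) + A) := by linarith [htv, habs, hsumE]
      _ ≤ 11 / 9 * U + 3 / 2 * (A + R) := by rw [hUb, hd]; nlinarith [hA0, hR0, hU]
  -- the export
  refine ⟨Us, fun i => ∑ u, wr i u, fun i => ∑ u, |wr i u|, hUs0, hUss, fun i => abs_sum_le_sum_abs _ _,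
    fun i hi => ⟨hmr i hi, hνr i hi⟩, fun i hi => ?_, by rw [hUs0] at hneg'; exact hneg', fun i hi => ?_, fun i hi k hk k' hk' => ?_,
    fun k hk k' hk' => ?_⟩
  · simp only [hwr_zero i hi, abs_zero, sum_const_zero, and_self]
  · obtain ⟨⟨hUi0, hUiU⟩, hdev⟩ := hmain i hi
    refine ⟨hUi0, by rw [hUs0] at hUiU; exact hUiU, fun k hk k' hk' => ?_⟩
    have hent := le_esup (𝒞r i - ((Us i : ℝ) : ℂ) • onesArr) ⟨k, hk⟩ ⟨k', hk'⟩
    have heq : (𝒞r i - ((Us i : ℝ) : ℂ) • onesArr : ↥B → ↥B → ℂ) ⟨k, hk⟩ ⟨k', hk'⟩ = C i k k' - ((Us i : ℝ) : ℂ) := by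
      simp only [Pi.sub_apply, Pi.smul_apply, smul_eq_mul, onesArr, mul_one, h𝒞r, resArr]
    rw [heq] at hent
    refine hent.trans (hdev.trans (le_of_eq ?_))
    rw [hA, hR, hSτ]
  · have h := hincr i hi ⟨k, hk⟩ ⟨k', hk'⟩
    simp only [h𝒞r, resArr, he] at h
    refine h.trans (le_of_eq ?_)
    rw [hUb, hd, hA, hR, hSτ]
    ring
  · have h := hTV ⟨k, hk⟩ ⟨k', hk'⟩
    simp only [h𝒞r, resArr] at h
    refine h.trans (le_of_eq ?_)
    rw [hA, hR, hSτ]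

/-- **The same for an AMPLITUDE family read on the ball through its truncated array** (hypotheses of `amplitudeLadder_envelope_edge` verbatim). -/
theorem amplitudeLadder_variation_edge (B : Finset S) (𝒜 : ℕ → S → S → ℂ)
    {U b ι₀ : ℝ} (hU : 0 ≤ U) (hι₀ : 0 ≤ ι₀) (τ : ℕ → ℝ) (hτ0 : ∀ j, 0 ≤ τ j) {n : ℕ}
    (X : ℕ → S → S → ℝ) {Xtot Xsup : ℝ} (hX0 : ∀ j k k', 0 ≤ X j k k')
    (hXsup : ∀ i < n, ∀ k k', X (i + 1) k k' ≤ Xsup) (hXtot : ∀ k k', X 0 k k' + ∑ i ∈ range n, X (i + 1) k k' ≤ Xtot)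
    (hXtot0 : 0 ≤ Xtot) (hXsup0 : 0 ≤ Xsup) (δ : ℕ → ℝ) (hneg : 16 * U * ∑ i ∈ range n, δ i ≤ 1)
    (h0 : ∀ k ∈ B, ∀ k' ∈ B, ‖𝒜 0 k k' - (U : ℂ)‖ ≤ ι₀ + X 0 k k')
    (hsteps : ∀ i < n, ∃ w : S → ℝ, (∑ p, |w p| ≤ b) ∧ (∑ p, (|w p| - w p) ≤ δ i) ∧
      ∃ N : Matrix S S ℂ,
        (1 + Matrix.diagonal (fun p => (w p : ℂ)) * Matrix.of (fun s t => if s ∈ B ∧ t ∈ B then 𝒜 i s t else 0)) * N = 1 ∧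
        ∀ k ∈ B, ∀ k' ∈ B,
          ‖𝒜 (i + 1) k k' - (Matrix.of (fun s t => if s ∈ B ∧ t ∈ B then 𝒜 i s t else 0) * N) k k'‖ ≤ τ i + X (i + 1) k k')
    (hsmall : 8 * 42 * ((ι₀ + ∑ j ∈ range n, τ j + Xtot) + (∑ j ∈ range n, τ j + Xsup)) * (b * n) ≤ 1) :
    ∃ Us W m : ℕ → ℝ, Us 0 = U ∧ (∀ i, Us (i + 1) = Us i / (1 + W i * Us i)) ∧
      (∀ i, |W i| ≤ m i) ∧ (∀ i < n, m i ≤ b ∧ m i - W i ≤ δ i) ∧ (∀ i, n ≤ i → W i = 0 ∧ m i = 0) ∧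
      16 * U * ∑ i ∈ range n, (m i - W i) ≤ 1 ∧
      (∀ i ≤ n, 0 ≤ Us i ∧ Us i ≤ 16 / 15 * U ∧ ∀ k ∈ B, ∀ k' ∈ B,
        ‖𝒜 i k k' - (Us i : ℂ)‖ ≤ 12 * ((ι₀ + ∑ j ∈ range n, τ j + Xtot) + (∑ j ∈ range n, τ j + Xsup))) ∧
      (∀ i < n, ∀ k ∈ B, ∀ k' ∈ B,
        ‖𝒜 (i + 1) k k' - 𝒜 i k k' - ((Us (i + 1) - Us i : ℝ) : ℂ)‖ ≤
          m i * ((2 * (16 / 15 * U) + 12 * ((ι₀ + ∑ j ∈ range n, τ j + Xtot) + (∑ j ∈ range n, τ j + Xsup)) +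
              (∑ j ∈ range n, τ j + Xsup)) * (12 * ((ι₀ + ∑ j ∈ range n, τ j + Xtot) + (∑ j ∈ range n, τ j + Xsup))) +
            (∑ j ∈ range n, τ j + Xsup) * (16 / 15 * U)) + τ i + X (i + 1) k k') ∧
      ∀ k ∈ B, ∀ k' ∈ B, ∑ i ∈ range n, ‖𝒜 (i + 1) k k' - 𝒜 i k k'‖ ≤
        11 / 9 * U + 3 / 2 * ((ι₀ + ∑ j ∈ range n, τ j + Xtot) + (∑ j ∈ range n, τ j + Xsup)) := by
  have h := matrixLadder_variation_edge B (fun i => Matrix.of fun s t => if s ∈ B ∧ t ∈ B then 𝒜 i s t else 0)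
    (fun i u hu t => truncArr_apply_of_not_mem B (𝒜 i) hu t)
    hU hι₀ τ hτ0 X hX0 hXsup hXtot hXtot0 hXsup0 δ hneg
    (fun k hk k' hk' => by rw [truncArr_apply_of_mem B (𝒜 0) hk hk']; exact h0 k hk k' hk')
    (fun i hi => by
      obtain ⟨w, hwabs, hwneg, N, hN, hb⟩ := hsteps i hi
      exact ⟨w, hwabs, hwneg, N, hN, fun k hk k' hk' => by
        rw [truncArr_apply_of_mem B (𝒜 (i + 1)) hk hk']; exact hb k hk k' hk'⟩)
    hsmall
  obtain ⟨Us, W, m, hUs0, hlaw, hWm, hmb, hzero, hnegm, hdev, hinc, htv⟩ := h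
  refine ⟨Us, W, m, hUs0, hlaw, hWm, hmb, hzero, hnegm, fun i hi => ?_, fun i hi k hk k' hk' => ?_, fun k hk k' hk' => ?_⟩
  · obtain ⟨hUi0, hUiU, hd⟩ := hdev i hi
    exact ⟨hUi0, hUiU, fun k hk k' hk' => by rw [← truncArr_apply_of_mem B (𝒜 i) hk hk']; exact hd k hk k' hk'⟩
  · have h := hinc i hi k hk k' hk'
    rwa [truncArr_apply_of_mem B (𝒜 (i + 1)) hk hk', truncArr_apply_of_mem B (𝒜 i) hk hk'] at h
  · have h := htv k hk k' hk'
    refine le_trans (le_of_eq (sum_congr rfl fun i _ => ?_)) h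
    rw [truncArr_apply_of_mem B (𝒜 (i + 1)) hk hk', truncArr_apply_of_mem B (𝒜 i) hk hk']

end Summit.HubbardSuperconductivity.HubbardSuperconductivity.Theorems.SWaveCascade

end
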